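import Summits.MatrixMultiplication.MatrixMultiplication.Theses.ToricBorderRank

/-!
# Route `ToricBorderRank` — the assembly item

Item `stmt-MatrixMultiplication-9969` (`Assembly`) of route
`route-MatrixMultiplication-ToricBorderRank` is the implication
`ToricExponentTwo → ToricDegeneration → MatrixMultiplication`: toric witnesses of exponent two
together with the toric degeneration lemma (BCS Prop. 15.30 read backwards) give `ω(ℂ) = 2`.
This is literally the type of the route's deciding theorem `closes` (gate-certified, sorry-free,
proved in the route file: for `ε > 0` take `N ≥ 2`, weights and an honest `T` with
`R(T) ≤ N^(2+ε)`; the degeneration lemma gives `bR(⟨N,N,N⟩) ≤ R(T) ≤ r := max (R T) 1`, Bini's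
theorem `Blaser2013_thm66_holds.cubic` gives `ω(ℂ) ≤ log_N r ≤ 2 + ε`, and `omega_two_le ℂ`
closes).  This file closes the item by applying `closes`.
-/

-- single-conjunct summit: the mandated namespace `Summit.MatrixMultiplication.MatrixMultiplication.…`
-- repeats `MatrixMultiplication` (summit = sub-problem), which `linter.dupNamespace` would flag.
set_option linter.dupNamespace false

namespace Summit.MatrixMultiplication.MatrixMultiplication.Theorems

open Summit.MatrixMultiplication.MatrixMultiplication.Theses.ToricBorderRank

/-- The assembly item of route `ToricBorderRank`: toric witnesses of exponent two
(`ToricExponentTwo`) and the toric degeneration lemma (`ToricDegeneration`) imply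
`MatrixMultiplication` (i.e. `ω(ℂ) = 2`). This is exactly the route's deciding theorem
`closes`. -/
theorem toricBorderRank_assembly_proof :
    Summit.MatrixMultiplication.MatrixMultiplication.Theses.ToricBorderRank.Assembly := by
  unfold Summit.MatrixMultiplication.MatrixMultiplication.Theses.ToricBorderRank.Assembly
  exact fun hX hD => closes hX hD

end Summit.MatrixMultiplication.MatrixMultiplication.Theorems
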